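import Literature.NumberTheory.LFunctions.Zhang2022.Section2SecondOrder

/-!
# Zhang (2022) §2: the indirect route (2.17)–(2.20) is the direct positivity (2.16) on a pencil

Companion to `Section2SecondOrder` (repair cell `pub-zhang`: audit + repair census of Y. Zhang,
*Discrete mean estimates and the Landau–Siegel zero*, arXiv:2211.02515v1 (2022)
[Zhang2022LandauSiegel]; the cell's verdict on that manuscript is NEGATIVE — the printed inequality
(8.24) fails, `Zhang2022.not_ineq824` — and **this file makes no claim about its Theorems 1–2 and
no claim about Landau–Siegel zeros**). Finite-sum algebra over the datum `EndgameData` of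
`Section2Assembly`; no asymptotics, no number theory.

The manuscript motivates its "variant" route as follows [§2, after (2.16)]: a direct contradiction
with the positivity (2.16) `Σ 𝔠*|𝔥|²ω ≥ 0` for a suitable `𝔥` is not attempted; instead the cross
means `Ξ₁*, Ξ₂*, Ξ₃*` of (2.17)–(2.20) are introduced and `|Ξ₁*| ≤ Ξ₂* + Ξ₃*` (2.18) is contradicted
by Propositions 2.4–2.6. This file records, exactly and at every order, that the two routes coincide
on the pencil `𝔥_t := H₁ + Z·H̄₂ − t·J₁` (`ghost t` of `Section2SecondOrder`):

* `form216_ghost_eq` — `𝔉(𝔥_t) = Ξ₁ − 2·Re(t̄·(Ξ₁* − δ)) + |t|²·Ξ_J` for every `t ∈ ℂ`, where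
  `δ = afeDefectCross` (`|δ| ≤ Ξ₃*`, `norm_afeDefectCross_le_xiStar3`) — a rearrangement of
  `xi1_eq_decomp` and `xiStar1_eq_decomp`;
* `form216_ghost_ray` — on the ray `t = s·(Ξ₁* − δ)/|Ξ₁* − δ|` (for `Ξ₁* − δ ≠ 0`),
  `𝔉(𝔥_t) = Ξ₁ − 2s|Ξ₁* − δ| + s²Ξ_J`;
* `form216_ghost_ray_le` — under the four inputs of `EndgameData.false_of_closing`
  (`|Ξ₁*| ≥ d𝔞𝔓`, `Ξ₁ ≤ q𝔞𝔓`, `Ξ_J ≤ c_J𝔞𝔓`, `Ξ₃* ≤ ε𝔞𝔓`), `s ≥ 0`, and the side condition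
  `Ξ₁* − δ ≠ 0` (hypothesis `hX`): `𝔉(𝔥_t) ≤ q𝔞𝔓 − 2s(d − ε)𝔞𝔓 + s²c_J𝔞𝔓 =: P(s)`
  (`pencilBound`); `xiStar1_sub_afeDefectCross_ne_zero` shows that `hX` already follows from the
  inputs `|Ξ₁*| ≥ d𝔞𝔓`, `Ξ₃* ≤ ε𝔞𝔓` once `ε < d` and `𝔞𝔓 > 0` (indeed `|Ξ₁* − δ| ≥ (d − ε)𝔞𝔓`,
  `norm_xiStar1_sub_afeDefectCross_ge`), and `form216_ghost_ray_le_pencilBound` is the `hX`-free form.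

The closing condition and the pencil bound are then matched AS THEOREMS (pure real algebra, for
`𝔞𝔓 > 0`, `q ≥ 0`, `c_J ≥ 0`, no sign condition on `d − ε`):

* `exists_pencilBound_neg_iff` — `(∃ s ≥ 0, P(s) < 0) ↔ √(q c_J) + ε < d` (witness `s = (d − ε)/c_J`,
  resp. `s = (q + 1)/(2(d − ε))` when `c_J = 0`; the converse through `2s√(q c_J) ≤ q + s²c_J`,
  `two_mul_sqrt_mul_le`), with the one-sided forms `sqrt_add_lt_of_pencilBound_neg`,
  `exists_pencilBound_neg_of_closing`, and the tightness statement `pencilBound_nonneg_of_not_closing`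
  (if `d ≤ √(q c_J) + ε` the pencil bound detects nothing: `P(s) ≥ 0` for all `s ≥ 0` — and by
  `EndgameData.exists_consistent` the four inputs are then consistent);
* `exists_form216_ghost_lt_zero_of_closing` — under the same six hypotheses as
  `EndgameData.false_of_closing`, in the same order (`𝔞𝔓 > 0`, `√(q c_J) + ε < d`, the four inputs),
  the positivity (2.16) FAILS at an explicit `𝔥_t` of the pencil: `∃ t, 𝔉(𝔥_t) < 0`. With
  `form216_nonneg (ghost t)` this is `False` in one step — `false_of_closing` reached by the direct route
  rather than through (2.18) (no second declaration of that `False` statement is made: the tree keeps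
  one, `EndgameData.false_of_closing`).

So the (A)-world bounds close the indirect skeleton precisely when they force the DIRECT sum (2.16) of
the explicit three-piece test vector `𝔥_t` to be negative: the variant is the direct route tested on this
pencil, and census cell V12 (a) of the cell's REPAIR-CENSUS (two-sided margin-0 designs, second order) is
the direct route's question at second order on that pencil (`b2b-zhang-alt-2/ALT-2.md` §§12–13).
Verdict-neutral; all declarations elementary, tagged `[folklore]`.
-/

noncomputable section

open Complex Real ComplexConjugate Finset

namespace Literature.NumberTheory.LFunctions.Zhang2022

namespace EndgameData

variable {ι : Type*} [Fintype ι] (E : EndgameData ι)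

/-- (2.16) on the pencil `𝔥_t = H₁ + ZH̄₂ − tJ₁`, exactly: `𝔉(𝔥_t) = Ξ₁ − 2Re(t̄(Ξ₁* − δ)) + |t|²Ξ_J`. [folklore] -/
theorem form216_ghost_eq (t : ℂ) :
    E.form216 (E.ghost t)
      = E.xi1 - 2 * (conj t * (E.xiStar1 - E.afeDefectCross)).re + ‖t‖ ^ 2 * E.xiJ := by
  have h1 := E.xi1_eq_decomp t
  have hk : E.kernelPairing t = E.xiStar1 - E.afeDefectCross - t * (E.xiJ : ℂ) := by
    have h2 := E.xiStar1_eq_decomp t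
    rw [h2]; ring
  have haux : (conj t * E.kernelPairing t).re
      = (conj t * (E.xiStar1 - E.afeDefectCross)).re - ‖t‖ ^ 2 * E.xiJ := by
    have : conj t * E.kernelPairing t
        = conj t * (E.xiStar1 - E.afeDefectCross) - ((‖t‖ ^ 2 * E.xiJ : ℝ) : ℂ) := by
      rw [hk, Complex.ofReal_mul, Complex.ofReal_pow, ← Complex.conj_mul' t]
      ring
    rw [this, Complex.sub_re, Complex.ofReal_re]
  rw [haux] at h1
  linarith

/-- Along the ray `t = s·u` with `u` the phase of `Ξ₁* − δ`
(`X := Ξ₁* − δ ≠ 0`, `s` real), `Re(t̄ X) = s·|X|`, so `𝔉(𝔥_t) = Ξ₁ − 2s|X| + s²Ξ_J`. [folklore] -/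
theorem form216_ghost_ray (s : ℝ) (hX : E.xiStar1 - E.afeDefectCross ≠ 0) :
    E.form216 (E.ghost ((s : ℂ) * ((E.xiStar1 - E.afeDefectCross) / (‖E.xiStar1 - E.afeDefectCross‖ : ℂ))))
      = E.xi1 - 2 * s * ‖E.xiStar1 - E.afeDefectCross‖ + s ^ 2 * E.xiJ := by
  set X := E.xiStar1 - E.afeDefectCross with hXdef
  have hXn : (‖X‖ : ℂ) ≠ 0 := by exact_mod_cast (norm_ne_zero_iff.mpr hX)
  rw [form216_ghost_eq]
  have hnorm : ‖(s : ℂ) * (X / (‖X‖ : ℂ))‖ = |s| := by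
    rw [norm_mul, Complex.norm_real, norm_div, Complex.norm_real, Real.norm_eq_abs, Real.norm_eq_abs,
      abs_norm, div_self (norm_ne_zero_iff.mpr hX), mul_one]
  have hre : (conj ((s : ℂ) * (X / (‖X‖ : ℂ))) * X).re = s * ‖X‖ := by
    have : conj ((s : ℂ) * (X / (‖X‖ : ℂ))) * X = ((s * ‖X‖ : ℝ) : ℂ) := by
      rw [map_mul, Complex.conj_ofReal, map_div₀, Complex.conj_ofReal]
      have hcm : conj X * X = ((‖X‖ : ℂ)) ^ 2 := Complex.conj_mul' X
      calc (s : ℂ) * (conj X / (‖X‖ : ℂ)) * X = (s : ℂ) * ((conj X * X) / (‖X‖ : ℂ)) := by ring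
        _ = (s : ℂ) * (((‖X‖ : ℂ)) ^ 2 / (‖X‖ : ℂ)) := by rw [hcm]
        _ = ((s * ‖X‖ : ℝ) : ℂ) := by rw [sq, mul_div_assoc, div_self hXn, mul_one]; push_cast; ring
    rw [this, Complex.ofReal_re]
  rw [hnorm, hre, sq_abs]
  ring

/-- Under the four (A)-world inputs of `false_of_closing`, for `s ≥ 0`,
`𝔉(𝔥_{s·u}) ≤ q𝔞𝔓 − 2s(d − ε)𝔞𝔓 + s²c_J𝔞𝔓` (with `u` the phase of `Ξ₁* − δ`); its minimum over `s ≥ 0` is negative iff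
`(d − ε)² > q·c_J`, the closing condition of `EndgameData.false_of_closing`. [folklore] -/
theorem form216_ghost_ray_le {aP d q cJ ε s : ℝ} (hs : 0 ≤ s)
    (hd : d * aP ≤ ‖E.xiStar1‖) (hq : E.xi1 ≤ q * aP) (hcJ : E.xiJ ≤ cJ * aP) (h3 : E.xiStar3 ≤ ε * aP)
    (hX : E.xiStar1 - E.afeDefectCross ≠ 0) :
    E.form216 (E.ghost ((s : ℂ) * ((E.xiStar1 - E.afeDefectCross) / (‖E.xiStar1 - E.afeDefectCross‖ : ℂ))))
      ≤ q * aP - 2 * s * ((d - ε) * aP) + s ^ 2 * (cJ * aP) := by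
  rw [E.form216_ghost_ray s hX]
  have hXlow : (d - ε) * aP ≤ ‖E.xiStar1 - E.afeDefectCross‖ := by
    have h := norm_sub_norm_le E.xiStar1 E.afeDefectCross
    have hδ := E.norm_afeDefectCross_le_xiStar3
    linarith
  have h2s : 0 ≤ 2 * s := by linarith
  have hsq : 0 ≤ s ^ 2 := sq_nonneg s
  nlinarith [mul_le_mul_of_nonneg_left hXlow h2s, mul_le_mul_of_nonneg_left hcJ hsq]

end EndgameData

/-! ### The pencil bound as a function of `s`, and its sign (pure real algebra) -/

/-- The pencil bound of `EndgameData.form216_ghost_ray_le`: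
`P(s) := q𝔞𝔓 − 2s(d − ε)𝔞𝔓 + s²c_J𝔞𝔓`. [folklore] -/
def pencilBound (aP d q cJ ε s : ℝ) : ℝ :=
  q * aP - 2 * s * ((d - ε) * aP) + s ^ 2 * (cJ * aP)

/-- `P(s) = 𝔞𝔓·(q − 2s(d − ε) + s²c_J)`. [folklore] -/
theorem pencilBound_eq_mul (aP d q cJ ε s : ℝ) :
    pencilBound aP d q cJ ε s = aP * (q - 2 * s * (d - ε) + s ^ 2 * cJ) := by
  unfold pencilBound; ring

/-- Completing the square (for `c_J ≠ 0`):
`P(s) = 𝔞𝔓·(c_J (s − (d − ε)/c_J)² + (q − (d − ε)²/c_J))`. [folklore] -/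
theorem pencilBound_eq_sq (aP d q cJ ε s : ℝ) (hcJ : cJ ≠ 0) :
    pencilBound aP d q cJ ε s
      = aP * (cJ * (s - (d - ε) / cJ) ^ 2 + (q - (d - ε) ^ 2 / cJ)) := by
  unfold pencilBound; field_simp; ring

/-- AM–GM in the form used here: `2s√(q c_J) ≤ q + s²c_J` for `q, c_J ≥ 0` and every real `s`. [folklore] -/
theorem two_mul_sqrt_mul_le {q cJ : ℝ} (hq : 0 ≤ q) (hcJ : 0 ≤ cJ) (s : ℝ) :
    2 * s * Real.sqrt (q * cJ) ≤ q + s ^ 2 * cJ := by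
  set r := Real.sqrt (q * cJ) with hr
  have hr0 : 0 ≤ r := Real.sqrt_nonneg _
  have hr2 : r ^ 2 = q * cJ := Real.sq_sqrt (mul_nonneg hq hcJ)
  rw [← not_lt]
  intro hcon
  have hA : 0 ≤ q + s ^ 2 * cJ := by positivity
  have hpos : 0 < (2 * s * r - (q + s ^ 2 * cJ)) * (2 * s * r + (q + s ^ 2 * cJ)) :=
    mul_pos (by linarith) (by linarith)
  have h6 : s ^ 2 * r ^ 2 = s ^ 2 * (q * cJ) := by rw [hr2]
  nlinarith [sq_nonneg (q - s ^ 2 * cJ), hpos, h6]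

/-- If the pencil bound is negative at some `s ≥ 0` then the closing condition holds:
`P(s) < 0 ⇒ √(q c_J) + ε < d` (for `𝔞𝔓 > 0`, `q, c_J ≥ 0`). [folklore] -/
theorem sqrt_add_lt_of_pencilBound_neg {aP d q cJ ε s : ℝ} (haP : 0 < aP) (hq : 0 ≤ q)
    (hcJ : 0 ≤ cJ) (hs : 0 ≤ s) (h : pencilBound aP d q cJ ε s < 0) :
    Real.sqrt (q * cJ) + ε < d := by
  have h1 : q - 2 * s * (d - ε) + s ^ 2 * cJ < 0 := by
    rw [pencilBound_eq_mul] at h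
    by_contra hcon
    exact absurd h (not_lt.mpr (mul_nonneg haP.le (not_lt.mp hcon)))
  have h3 := two_mul_sqrt_mul_le hq hcJ s
  rw [← not_le]
  intro hcon
  have h4 : 2 * s * (d - ε) ≤ 2 * s * Real.sqrt (q * cJ) :=
    mul_le_mul_of_nonneg_left (by linarith) (by linarith)
  linarith

/-- Conversely the closing condition makes the pencil bound negative at an explicit `s ≥ 0`
(`s = (d − ε)/c_J` if `c_J > 0`, `s = (q + 1)/(2(d − ε))` if `c_J = 0`). [folklore] -/
theorem exists_pencilBound_neg_of_closing {aP d q cJ ε : ℝ} (haP : 0 < aP) (hq : 0 ≤ q)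
    (hcJ : 0 ≤ cJ) (hclose : Real.sqrt (q * cJ) + ε < d) :
    ∃ s : ℝ, 0 ≤ s ∧ pencilBound aP d q cJ ε s < 0 := by
  have hr0 : 0 ≤ Real.sqrt (q * cJ) := Real.sqrt_nonneg _
  have hdε : 0 < d - ε := by linarith
  rcases hcJ.eq_or_lt with h0 | hpos
  · -- `c_J = 0`: the bound is affine in `s` with negative slope
    subst h0
    refine ⟨(q + 1) / (2 * (d - ε)), by positivity, ?_⟩
    have hval : pencilBound aP d q 0 ε ((q + 1) / (2 * (d - ε))) = -aP := by
      have hne : d - ε ≠ 0 := hdε.ne'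
      unfold pencilBound; field_simp; ring
    rw [hval]; linarith
  · -- `c_J > 0`: the vertex `s = (d − ε)/c_J`
    refine ⟨(d - ε) / cJ, div_nonneg hdε.le hpos.le, ?_⟩
    have hval : pencilBound aP d q cJ ε ((d - ε) / cJ) = aP * (q * cJ - (d - ε) ^ 2) / cJ := by
      have hne : cJ ≠ 0 := hpos.ne'
      unfold pencilBound; field_simp; ring
    rw [hval]
    have hr2 : Real.sqrt (q * cJ) ^ 2 = q * cJ := Real.sq_sqrt (mul_nonneg hq hpos.le)
    have hlt : q * cJ < (d - ε) ^ 2 := by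
      have hprod : 0 < (d - ε - Real.sqrt (q * cJ)) * (d - ε + Real.sqrt (q * cJ)) :=
        mul_pos (by linarith) (by linarith)
      nlinarith [hprod, hr2]
    exact div_neg_of_neg_of_pos (mul_neg_of_pos_of_neg haP (by linarith)) hpos

/-- The pencil bound is negative at some `s ≥ 0` iff the closing condition of
`EndgameData.false_of_closing` / `EndgameData.exists_consistent` holds:
`(∃ s ≥ 0, P(s) < 0) ↔ √(q c_J) + ε < d` (for `𝔞𝔓 > 0`, `q, c_J ≥ 0`). [folklore] -/
theorem exists_pencilBound_neg_iff {aP d q cJ ε : ℝ} (haP : 0 < aP) (hq : 0 ≤ q) (hcJ : 0 ≤ cJ) :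
    (∃ s : ℝ, 0 ≤ s ∧ pencilBound aP d q cJ ε s < 0) ↔ Real.sqrt (q * cJ) + ε < d :=
  ⟨fun ⟨_, hs, h⟩ => sqrt_add_lt_of_pencilBound_neg haP hq hcJ hs h,
    exists_pencilBound_neg_of_closing haP hq hcJ⟩

/-- Tightness: if the closing condition fails (`d ≤ √(q c_J) + ε`) the pencil bound is `≥ 0` at every
`s ≥ 0` — on this pencil the direct route detects nothing beyond the indirect skeleton (and the four
inputs are then consistent, `EndgameData.exists_consistent`). [folklore] -/
theorem pencilBound_nonneg_of_not_closing {aP d q cJ ε s : ℝ} (haP : 0 < aP) (hq : 0 ≤ q)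
    (hcJ : 0 ≤ cJ) (h : d ≤ Real.sqrt (q * cJ) + ε) (hs : 0 ≤ s) :
    0 ≤ pencilBound aP d q cJ ε s := by
  rw [← not_lt]
  intro hcon
  exact absurd (sqrt_add_lt_of_pencilBound_neg haP hq hcJ hs hcon) (not_lt.mpr h)

namespace EndgameData

variable {ι : Type*} [Fintype ι] (E : EndgameData ι)

/-- From `|Ξ₁*| ≥ d𝔞𝔓` and `|δ| ≤ Ξ₃* ≤ ε𝔞𝔓`: `|Ξ₁* − δ| ≥ (d − ε)𝔞𝔓`. [folklore] -/
theorem norm_xiStar1_sub_afeDefectCross_ge {aP d ε : ℝ} (hd : d * aP ≤ ‖E.xiStar1‖)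
    (h3 : E.xiStar3 ≤ ε * aP) : (d - ε) * aP ≤ ‖E.xiStar1 - E.afeDefectCross‖ := by
  have h := norm_sub_norm_le E.xiStar1 E.afeDefectCross
  have hδ := E.norm_afeDefectCross_le_xiStar3
  linarith

/-- The side condition `hX : Ξ₁* − δ ≠ 0` of `form216_ghost_ray` / `form216_ghost_ray_le` follows from
two of the four inputs once `ε < d` and `𝔞𝔓 > 0` (in particular under the closing condition,
since `√(q c_J) ≥ 0`). [folklore] -/
theorem xiStar1_sub_afeDefectCross_ne_zero {aP d ε : ℝ} (haP : 0 < aP) (hεd : ε < d)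
    (hd : d * aP ≤ ‖E.xiStar1‖) (h3 : E.xiStar3 ≤ ε * aP) :
    E.xiStar1 - E.afeDefectCross ≠ 0 := by
  have hge := E.norm_xiStar1_sub_afeDefectCross_ge hd h3
  have hpos : 0 < (d - ε) * aP := mul_pos (by linarith) haP
  intro hzero
  rw [hzero, norm_zero] at hge
  linarith

/-- `hX`-free form of `form216_ghost_ray_le`: under the four inputs, `𝔞𝔓 > 0`, `ε < d` and `s ≥ 0`,
`𝔉(𝔥_{s·u}) ≤ P(s)` (`pencilBound`). [folklore] -/
theorem form216_ghost_ray_le_pencilBound {aP d q cJ ε s : ℝ} (haP : 0 < aP) (hεd : ε < d)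
    (hs : 0 ≤ s) (hd : d * aP ≤ ‖E.xiStar1‖) (hq : E.xi1 ≤ q * aP) (hcJ : E.xiJ ≤ cJ * aP)
    (h3 : E.xiStar3 ≤ ε * aP) :
    E.form216 (E.ghost ((s : ℂ) * ((E.xiStar1 - E.afeDefectCross) / (‖E.xiStar1 - E.afeDefectCross‖ : ℂ))))
      ≤ pencilBound aP d q cJ ε s := by
  unfold pencilBound
  exact E.form216_ghost_ray_le hs hd hq hcJ h3 (E.xiStar1_sub_afeDefectCross_ne_zero haP hεd hd h3)

/-- THE DIRECT ROUTE. Under the six hypotheses of `false_of_closing`, in the same order (`𝔞𝔓 > 0`, the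
closing condition `√(q c_J) + ε < d`, the four (A)-world inputs), the positivity (2.16) fails at an
explicit vector of the pencil: `𝔉(𝔥_t) < 0` for some `t` (namely `t = s·(Ξ₁* − δ)/|Ξ₁* − δ|` with the
`s` of `exists_pencilBound_neg_of_closing`); `form216_nonneg (ghost t)` then gives `False`, i.e.
`false_of_closing` by the direct route. [folklore] -/
theorem exists_form216_ghost_lt_zero_of_closing {aP d q cJ ε : ℝ} (haP : 0 < aP)
    (hclose : Real.sqrt (q * cJ) + ε < d) (h24 : d * aP ≤ ‖E.xiStar1‖) (h232 : E.xi1 ≤ q * aP)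
    (h233 : E.xiJ ≤ cJ * aP) (h26 : E.xiStar3 ≤ ε * aP) :
    ∃ t : ℂ, E.form216 (E.ghost t) < 0 := by
  have hq : 0 ≤ q := by have := E.xi1_nonneg; nlinarith
  have hcJ : 0 ≤ cJ := by have := E.xiJ_nonneg; nlinarith
  have hεd : ε < d := by have := Real.sqrt_nonneg (q * cJ); linarith
  obtain ⟨s, hs, hneg⟩ := exists_pencilBound_neg_of_closing haP hq hcJ hclose
  exact ⟨_, (E.form216_ghost_ray_le_pencilBound haP hεd hs h24 h232 h233 h26).trans_lt hneg⟩

end EndgameData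

end Literature.NumberTheory.LFunctions.Zhang2022
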